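import Literature.NumberTheory.ComplexMultiplication.CMTorusIsomorphismClassesMaximalEndomorphismRingCount
import HarnessLib

/-!
# Monotonicity in the order: `#`(CM tori with multiplication by `S`) `≤ #`(with multiplication by `𝔯 ⊆ S`);
# `h_K` and `#Pic(𝔯)` as the extremes, attained exactly at the maximal order

Layer A3 of the Hodge/CM programme (docs/m5/MAPPING.md §1), the "arbitrary order" series.  For orders
`𝔯 = endOrder (M_μ) ⊆ S = endOrder (M_ν)` of the CM field `K` and a CM type `Φ`:

* §1 `equivalence_exists_smul_span_eq` (homothety of lattices is an equivalence relation on every family),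
  **`natCard_quot_smul_span_eq_le_of_le`** / **`natCard_quot_exists_bijective_comm_le_of_le`** — the `K`-isomorphism
  classes of the CM tori `(ℂ^Φ/D(𝔪), ι)` with `ι(S) ⊆ End` form a SUBSET of those with `ι(𝔯) ⊆ End` (same tori, same
  isomorphisms): `#` classes is antitone in the order; ideal level `natCard_quot_fractionalIdeal_le_of_le`:
  `#ICM(S) ≤ #ICM(𝔯)` [Marseglia2019, §2 («a fractional `S`-ideal is … a fractional `R`-ideal»), §3 Def. 3.1];
* §2 the two extremes: **`classNumber_le_natCard_quot_exists_bijective_comm`** (`h_K ≤ #` classes — Shimura's `h`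
  principal ones are always there) and **`natCard_quot_exists_bijective_comm_eq_classNumber_iff`** (`= h_K` IFF
  `𝔯 = 𝓞_K`); **`natCard_classGroup_endOrder_le_natCard_quot_fractionalIdeal`** (`#Pic(𝔯) ≤ #ICM(𝔯)`, any degree)
  and **`natCard_classGroup_eq_natCard_quot_fractionalIdeal_iff`** («equality holds if and only if `R = 𝒪_K`»)
  [Marseglia2019, §3 remark after Def. 3.5, p. 6] [Shimura1998, §7.4 Prop. 17].

* §3 strict: **`natCard_quot_exists_bijective_comm_lt_of_lt`** / `natCard_quot_fractionalIdeal_lt_of_lt` — for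
  `𝔯 ⊊ S` STRICTLY fewer classes (`#ICM(S) < #ICM(𝔯)`): the class of `𝔯` itself has order exactly `𝔯`
  [Marseglia2019, §3 Lemma 3.6].

Conventions as in `CMTorusIsomorphismClassesOrderFinite` / `CMOrderWeakClassesCount`.  Theorems only (no new
definitions, no named facts).

## References
* [Shimura1998] G. Shimura, *Abelian varieties with complex multiplication and modular functions*, PUP 1998 —
  §7.4 Props. 15–17, pp. 57–58.
* [Marseglia2019] S. Marseglia, *Computing the ideal class monoid of an order*, J. Lond. Math. Soc. 101 (2020),
  arXiv:1805.09671 — §2 p. 4; §3 Def. 3.1, Def. 3.5 and remark, Lemma 3.6, p. 6.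
-/

noncomputable section

open scoped Classical nonZeroDivisors NumberField Pointwise
open NumberField Module FractionalIdeal

namespace Literature.NumberTheory.ComplexMultiplication

open Literature.AlgebraicGeometry.Motives (CMType)
open Literature.AlgebraicGeometry.ComplexMultiplication (CMTorus.periodEquiv)
open Literature.Geometry.Kaehler
open Literature.Geometry.Kaehler.ComplexTorus (mapMatrix)

namespace CMTypeLattice

section Monotone

variable {K : Type} [Field K] [NumberField K]
variable {ι : Type} [Fintype ι] [DecidableEq ι] (μ ν : Basis ι ℚ K)

/-! ## §1 The classes with multiplication by `S` are among the classes with multiplication by `𝔯 ⊆ S` -/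

omit [Fintype ι] [DecidableEq ι] in
/-- **Homothety `a𝔪 = 𝔪′` of lattices of `K` is an equivalence relation** on every family of bases (reflexive
`a = 1`, symmetric `a⁻¹` — `a ≠ 0` as `𝔪′` spans `K` —, transitive by products). [cite: Marseglia2019, §3 Def. 3.1
(«isomorphic … `I = xJ`» is an equivalence relation), p. 6] -/
theorem equivalence_exists_smul_span_eq (p : Basis ι ℚ K → Prop) :
    Equivalence fun μ μ' : {μ : Basis ι ℚ K // p μ} =>
      ∃ a : K, a • Submodule.span ℤ (Set.range (μ : Basis ι ℚ K)) = Submodule.span ℤ (Set.range (μ' : Basis ι ℚ K)) := by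
  refine ⟨fun μ => ⟨1, one_smul _ _⟩, fun {μ μ'} => ?_, fun {μ μ' μ''} => ?_⟩
  · rintro ⟨a, ha⟩
    have ha0 : a ≠ 0 := by
      rintro rfl
      obtain ⟨j⟩ := (μ' : Basis ι ℚ K).index_nonempty
      have hj : (μ' : Basis ι ℚ K) j ∈ (0 : K) • Submodule.span ℤ (Set.range (μ : Basis ι ℚ K)) := by
        rw [ha]
        exact Submodule.subset_span ⟨j, rfl⟩
      obtain ⟨m, -, hm⟩ := (Submodule.mem_smul_pointwise_iff_exists _ _ _).1 hj
      exact (μ' : Basis ι ℚ K).ne_zero j (by rw [← hm, zero_smul])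
    exact ⟨a⁻¹, by rw [← ha, inv_smul_smul₀ ha0]⟩
  · rintro ⟨a, ha⟩ ⟨b, hb⟩
    exact ⟨b * a, by rw [mul_smul, ha, hb]⟩

/-- **The classes (mod `K^×`) of lattices with order `⊇ S` inject into the classes of lattices with order `⊇ 𝔯`**,
for `𝔯 = endOrder (M_μ) ≤ S = endOrder (M_ν)` (the same lattices, the same homotheties): `#` is antitone in the order.
[cite: Marseglia2019, §2 («every over-order `S` of `R` is a fractional `R`-ideal», and its ideals are `R`-ideals), p. 4] -/
theorem natCard_quot_smul_span_eq_le_of_le [IsFractionRing (endOrder (Algebra.leftMulMatrix μ)) K]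
    (hle : endOrder (Algebra.leftMulMatrix μ) ≤ endOrder (Algebra.leftMulMatrix ν)) :
    Nat.card (Quot fun μ' μ'' : {μ' : Basis ι ℚ K //
        endOrder (Algebra.leftMulMatrix ν) ≤ endOrder (Algebra.leftMulMatrix μ')} =>
      ∃ a : K, a • Submodule.span ℤ (Set.range (μ' : Basis ι ℚ K)) = Submodule.span ℤ (Set.range (μ'' : Basis ι ℚ K))) ≤
    Nat.card (Quot fun μ' μ'' : {μ' : Basis ι ℚ K //
        endOrder (Algebra.leftMulMatrix μ) ≤ endOrder (Algebra.leftMulMatrix μ')} =>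
      ∃ a : K, a • Submodule.span ℤ (Set.range (μ' : Basis ι ℚ K)) = Submodule.span ℤ (Set.range (μ'' : Basis ι ℚ K))) := by
  haveI : Nonempty ι := μ.index_nonempty
  haveI := EndOrder.finite_quot_fractionalIdeal (ρ := Algebra.leftMulMatrix μ) (K := K)
  haveI : Finite (Quot fun μ' μ'' : {μ' : Basis ι ℚ K //
        endOrder (Algebra.leftMulMatrix μ) ≤ endOrder (Algebra.leftMulMatrix μ')} =>
      ∃ a : K, a • Submodule.span ℤ (Set.range (μ' : Basis ι ℚ K)) = Submodule.span ℤ (Set.range (μ'' : Basis ι ℚ K))) :=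
    Finite.of_equiv _ (nonempty_quot_smul_span_eq_equiv_quot_fractionalIdeal μ).some.symm
  -- the relation on the larger family, named
  set r : {μ' : Basis ι ℚ K // endOrder (Algebra.leftMulMatrix μ) ≤ endOrder (Algebra.leftMulMatrix μ')} →
      {μ' : Basis ι ℚ K // endOrder (Algebra.leftMulMatrix μ) ≤ endOrder (Algebra.leftMulMatrix μ')} → Prop :=
    fun μ' μ'' => ∃ a : K, a • Submodule.span ℤ (Set.range (μ' : Basis ι ℚ K)) =
      Submodule.span ℤ (Set.range (μ'' : Basis ι ℚ K)) with hr
  have hequiv : Equivalence r :=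
    equivalence_exists_smul_span_eq fun μ' : Basis ι ℚ K => endOrder (Algebra.leftMulMatrix μ) ≤ endOrder (Algebra.leftMulMatrix μ')
  let g : {μ' : Basis ι ℚ K // endOrder (Algebra.leftMulMatrix ν) ≤ endOrder (Algebra.leftMulMatrix μ')} →
      {μ' : Basis ι ℚ K // endOrder (Algebra.leftMulMatrix μ) ≤ endOrder (Algebra.leftMulMatrix μ')} :=
    fun b => ⟨(b : Basis ι ℚ K), hle.trans b.2⟩
  refine Nat.card_le_card_of_injective (Quot.lift (fun b => Quot.mk r (g b)) fun b b' h => Quot.sound h)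
    fun q₁ q₂ h => ?_
  induction q₁ using Quot.ind with
  | mk b =>
    induction q₂ using Quot.ind with
    | mk b' =>
      have h' : Quot.mk r (g b) = Quot.mk r (g b') := h
      obtain ⟨a, ha⟩ := (hequiv.eqvGen_iff).1 (Quot.eqvGen_exact h')
      exact Quot.sound ⟨a, ha⟩

/-- **TORUS LEVEL: the `K`-isomorphism classes of the CM tori `(ℂ^Φ/D(𝔪), ι)` of type `(K, Φ)` with `ι(S) ⊆ End`
are at most as many as those with `ι(𝔯) ⊆ End`**, for orders `𝔯 ⊆ S` (a subset of the same set of classes).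
[cite: Shimura1998, §7.4 (the tori with `ι(𝔬) ⊆ End(A)` among all of type `(F; {φᵢ})`), pp. 57–58]
[cite: Marseglia2019, §2, p. 4] -/
theorem natCard_quot_exists_bijective_comm_le_of_le [IsFractionRing (endOrder (Algebra.leftMulMatrix μ)) K]
    (Φ : CMType K) (hle : endOrder (Algebra.leftMulMatrix μ) ≤ endOrder (Algebra.leftMulMatrix ν)) :
    Nat.card (Quot fun μ' μ'' : {μ' : Basis ι ℚ K //
        endOrder (Algebra.leftMulMatrix ν) ≤ endOrder (Algebra.leftMulMatrix μ')} =>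
      ∃ A : Matrix ι ι ℤ,
        Function.Bijective
            (mapMatrix (CMTorus.periodEquiv Φ (μ' : Basis ι ℚ K)) (CMTorus.periodEquiv Φ (μ'' : Basis ι ℚ K)) A) ∧
          ∀ α : K, A.map (Int.cast : ℤ → ℚ) * Algebra.leftMulMatrix (μ' : Basis ι ℚ K) α =
            Algebra.leftMulMatrix (μ'' : Basis ι ℚ K) α * A.map (Int.cast : ℤ → ℚ)) ≤
    Nat.card (Quot fun μ' μ'' : {μ' : Basis ι ℚ K //
        endOrder (Algebra.leftMulMatrix μ) ≤ endOrder (Algebra.leftMulMatrix μ')} =>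
      ∃ A : Matrix ι ι ℤ,
        Function.Bijective
            (mapMatrix (CMTorus.periodEquiv Φ (μ' : Basis ι ℚ K)) (CMTorus.periodEquiv Φ (μ'' : Basis ι ℚ K)) A) ∧
          ∀ α : K, A.map (Int.cast : ℤ → ℚ) * Algebra.leftMulMatrix (μ' : Basis ι ℚ K) α =
            Algebra.leftMulMatrix (μ'' : Basis ι ℚ K) α * A.map (Int.cast : ℤ → ℚ)) := by
  convert natCard_quot_smul_span_eq_le_of_le μ ν hle using 1
  · exact Nat.card_congr (Quot.congrRight fun b b' =>
      exists_bijective_comm_iff_exists_smul_span_eq Φ (b : Basis ι ℚ K) (b' : Basis ι ℚ K))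
  · exact Nat.card_congr (Quot.congrRight fun b b' =>
      exists_bijective_comm_iff_exists_smul_span_eq Φ (b : Basis ι ℚ K) (b' : Basis ι ℚ K))

/-- **`#ICM(S) ≤ #ICM(𝔯)` for orders `𝔯 ⊆ S`** (through the lattices: `ICM` of an order counts the classes of lattices
whose order contains it). [cite: Marseglia2019, §2 p. 4 and §3 Def. 3.1 / Cor. 3.4, p. 6] -/
theorem natCard_quot_fractionalIdeal_le_of_le [IsFractionRing (endOrder (Algebra.leftMulMatrix μ)) K]
    [IsFractionRing (endOrder (Algebra.leftMulMatrix ν)) K]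
    (hle : endOrder (Algebra.leftMulMatrix μ) ≤ endOrder (Algebra.leftMulMatrix ν)) :
    Nat.card (Quot fun M N : {M : FractionalIdeal (endOrder (Algebra.leftMulMatrix ν))⁰ K // M ≠ 0} =>
      ∃ x : K, x ≠ 0 ∧ (M : FractionalIdeal (endOrder (Algebra.leftMulMatrix ν))⁰ K) =
        spanSingleton (endOrder (Algebra.leftMulMatrix ν))⁰ x * N) ≤
    Nat.card (Quot fun M N : {M : FractionalIdeal (endOrder (Algebra.leftMulMatrix μ))⁰ K // M ≠ 0} =>
      ∃ x : K, x ≠ 0 ∧ (M : FractionalIdeal (endOrder (Algebra.leftMulMatrix μ))⁰ K) =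
        spanSingleton (endOrder (Algebra.leftMulMatrix μ))⁰ x * N) := by
  rw [← natCard_quot_smul_span_eq_eq ν, ← natCard_quot_smul_span_eq_eq μ]
  exact natCard_quot_smul_span_eq_le_of_le μ ν hle

/-! ## §2 The extremes: `h_K ≤ #`classes, `= h_K` iff `𝔯 = 𝓞_K`; `#Pic(𝔯) ≤ #ICM(𝔯)`, `=` iff `𝔯 = 𝓞_K` -/

variable [IsFractionRing (endOrder (Algebra.leftMulMatrix μ)) K]

/-- Two different strata fit in `ICM(𝔯)`: `#ICM_{S₁}(𝔯) + #ICM_{S₂}(𝔯) ≤ #ICM(𝔯)` (bookkeeping on the partition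
`ICM(𝔯) = ⊔_S ICM_S(𝔯)`). [cite: Marseglia2019, §3 Lemma 3.6 («`ICM(R) = ⊔ ICM_S`»), p. 6] -/
theorem natCard_quot_stratum_add_le {S₁ S₂ : Subring K} (hne : S₁ ≠ S₂)
    (h₁ : endOrder (Algebra.leftMulMatrix μ) ≤ S₁) (hfin₁ : Module.Finite ℤ S₁)
    (h₂ : endOrder (Algebra.leftMulMatrix μ) ≤ S₂) (hfin₂ : Module.Finite ℤ S₂) :
    Nat.card (Quot fun M N : {M : FractionalIdeal (endOrder (Algebra.leftMulMatrix μ))⁰ K //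
        M ≠ 0 ∧ ((M / M : FractionalIdeal (endOrder (Algebra.leftMulMatrix μ))⁰ K) : Set K) = S₁} =>
      ∃ x : K, x ≠ 0 ∧ (M : FractionalIdeal (endOrder (Algebra.leftMulMatrix μ))⁰ K) =
        spanSingleton (endOrder (Algebra.leftMulMatrix μ))⁰ x * N) +
    Nat.card (Quot fun M N : {M : FractionalIdeal (endOrder (Algebra.leftMulMatrix μ))⁰ K //
        M ≠ 0 ∧ ((M / M : FractionalIdeal (endOrder (Algebra.leftMulMatrix μ))⁰ K) : Set K) = S₂} =>
      ∃ x : K, x ≠ 0 ∧ (M : FractionalIdeal (endOrder (Algebra.leftMulMatrix μ))⁰ K) =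
        spanSingleton (endOrder (Algebra.leftMulMatrix μ))⁰ x * N) ≤
    Nat.card (Quot fun M N : {M : FractionalIdeal (endOrder (Algebra.leftMulMatrix μ))⁰ K // M ≠ 0} =>
      ∃ x : K, x ≠ 0 ∧ (M : FractionalIdeal (endOrder (Algebra.leftMulMatrix μ))⁰ K) =
        spanSingleton (endOrder (Algebra.leftMulMatrix μ))⁰ x * N) := by
  classical
  haveI : Nonempty ι := μ.index_nonempty
  rw [EndOrder.natCard_quot_fractionalIdeal_eq_sum_natCard_quot_stratum]
  have hsub : ({S₁, S₂} : Finset (Subring K)) ⊆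
      (EndOrder.finite_setOf_overorder (ρ := Algebra.leftMulMatrix μ) (K := K)).toFinset := by
    intro S hS
    rw [Set.Finite.mem_toFinset]
    rcases Finset.mem_insert.1 hS with rfl | hS
    · exact ⟨h₁, hfin₁⟩
    · rw [Finset.mem_singleton.1 hS]
      exact ⟨h₂, hfin₂⟩
  refine le_trans (le_of_eq ?_) (Finset.sum_le_sum_of_subset_of_nonneg hsub fun _ _ _ => Nat.zero_le _)
  rw [Finset.sum_pair hne]

/-- **`h_K ≤ #`(`K`-isomorphism classes of CM tori of type `(K, Φ)` with multiplication by `𝔯`)** for every order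
`𝔯`: the `h_K` classes with endomorphism ring `𝓞_K` (`CMTorusIsomorphismClassesMaximalEndomorphismRingCount`) are
among them. [cite: Shimura1998, §7.4 Prop. 17, p. 58] [cite: Marseglia2019, §3 («`ICM(R) ⊇ ⊔ Pic(S)`»), p. 6] -/
theorem classNumber_le_natCard_quot_exists_bijective_comm (Φ : CMType K) :
    classNumber K ≤ Nat.card (Quot fun μ' μ'' : {μ' : Basis ι ℚ K //
        endOrder (Algebra.leftMulMatrix μ) ≤ endOrder (Algebra.leftMulMatrix μ')} =>
      ∃ A : Matrix ι ι ℤ,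
        Function.Bijective
            (mapMatrix (CMTorus.periodEquiv Φ (μ' : Basis ι ℚ K)) (CMTorus.periodEquiv Φ (μ'' : Basis ι ℚ K)) A) ∧
          ∀ α : K, A.map (Int.cast : ℤ → ℚ) * Algebra.leftMulMatrix (μ' : Basis ι ℚ K) α =
            Algebra.leftMulMatrix (μ'' : Basis ι ℚ K) α * A.map (Int.cast : ℤ → ℚ)) := by
  classical
  haveI : Nonempty ι := μ.index_nonempty
  rw [natCard_quot_exists_bijective_comm_eq μ Φ, EndOrder.natCard_quot_fractionalIdeal_eq_sum_natCard_quot_stratum,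
    ← EndOrder.natCard_quot_stratum_range_eq_classNumber (Algebra.leftMulMatrix μ)]
  refine Finset.single_le_sum (f := fun S : Subring K => Nat.card (Quot fun M N :
      {M : FractionalIdeal (endOrder (Algebra.leftMulMatrix μ))⁰ K //
        M ≠ 0 ∧ ((M / M : FractionalIdeal (endOrder (Algebra.leftMulMatrix μ))⁰ K) : Set K) = S} =>
      ∃ x : K, x ≠ 0 ∧ (M : FractionalIdeal (endOrder (Algebra.leftMulMatrix μ))⁰ K) =
        spanSingleton (endOrder (Algebra.leftMulMatrix μ))⁰ x * N)) (fun _ _ => Nat.zero_le _) ?_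
  rw [Set.Finite.mem_toFinset]
  exact ⟨endOrder_le_range _, EndOrder.moduleFinite_of_le_range le_rfl⟩

/-- **`#` classes `= h_K` IF AND ONLY IF `𝔯` is the maximal order**: `⟸` is PROPOSITION 17
(`CMTorusIsomorphismClassesMaximalOrderCount`); `⟹` because a non-maximal `𝔯` contributes, besides the `h_K` classes
with endomorphism ring `𝓞_K`, at least the class of `𝔯` itself (endomorphism ring `𝔯 ≠ 𝓞_K`).
[cite: Shimura1998, §7.4 Prop. 17, p. 58] [cite: Marseglia2019, §3 (remark after Def. 3.5: «equality holds if and only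
if `R = 𝒪_K`»), p. 6] -/
theorem natCard_quot_exists_bijective_comm_eq_classNumber_iff (Φ : CMType K) :
    Nat.card (Quot fun μ' μ'' : {μ' : Basis ι ℚ K //
        endOrder (Algebra.leftMulMatrix μ) ≤ endOrder (Algebra.leftMulMatrix μ')} =>
      ∃ A : Matrix ι ι ℤ,
        Function.Bijective
            (mapMatrix (CMTorus.periodEquiv Φ (μ' : Basis ι ℚ K)) (CMTorus.periodEquiv Φ (μ'' : Basis ι ℚ K)) A) ∧
          ∀ α : K, A.map (Int.cast : ℤ → ℚ) * Algebra.leftMulMatrix (μ' : Basis ι ℚ K) α =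
            Algebra.leftMulMatrix (μ'' : Basis ι ℚ K) α * A.map (Int.cast : ℤ → ℚ)) = classNumber K ↔
    endOrder (Algebra.leftMulMatrix μ) = (algebraMap (𝓞 K) K).range := by
  haveI : Nonempty ι := μ.index_nonempty
  refine ⟨fun h => ?_, fun h => natCard_quot_exists_bijective_comm_eq_classNumber Φ μ fun a => h ▸ ⟨a, rfl⟩⟩
  by_contra hne
  -- the strata of `𝔯` and of `𝓞_K` are different and both nonempty: `1 + h_K ≤ #` classes
  have h2 := natCard_quot_stratum_add_le μ hne le_rfl (EndOrder.moduleFinite_of_le_range (endOrder_le_range _))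
    (endOrder_le_range _) (EndOrder.moduleFinite_of_le_range le_rfl)
  rw [EndOrder.natCard_quot_stratum_range_eq_classNumber, ← natCard_quot_exists_bijective_comm_eq μ Φ, h] at h2
  haveI := EndOrder.finite_quot_stratum (ρ := Algebra.leftMulMatrix μ) (K := K) (endOrder (Algebra.leftMulMatrix μ))
  haveI := EndOrder.nonempty_quot_stratum (ρ := Algebra.leftMulMatrix μ) (K := K) (S := endOrder (Algebra.leftMulMatrix μ))
    le_rfl (EndOrder.moduleFinite_of_le_range (endOrder_le_range _))
  have hpos := Nat.card_pos (α := Quot fun M N : {M : FractionalIdeal (endOrder (Algebra.leftMulMatrix μ))⁰ K //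
      M ≠ 0 ∧ ((M / M : FractionalIdeal (endOrder (Algebra.leftMulMatrix μ))⁰ K) : Set K) =
        (endOrder (Algebra.leftMulMatrix μ) : Set K)} =>
    ∃ x : K, x ≠ 0 ∧ (M : FractionalIdeal (endOrder (Algebra.leftMulMatrix μ))⁰ K) =
      spanSingleton (endOrder (Algebra.leftMulMatrix μ))⁰ x * N)
  omega

/-- **`#Pic(𝔯) ≤ #ICM(𝔯)`** in any degree («`Pic(R) ⊆ ICM(R)`»: the invertible classes are one stratum,
`Pic(𝔯) = ClassGroup 𝔯 ⊆ ICM_𝔯(𝔯)`). [cite: Marseglia2019, §3 Def. 3.5 and the remark after it, p. 6] -/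
theorem natCard_classGroup_endOrder_le_natCard_quot_fractionalIdeal :
    Nat.card (ClassGroup (endOrder (Algebra.leftMulMatrix μ))) ≤
      Nat.card (Quot fun M N : {M : FractionalIdeal (endOrder (Algebra.leftMulMatrix μ))⁰ K // M ≠ 0} =>
        ∃ x : K, x ≠ 0 ∧ (M : FractionalIdeal (endOrder (Algebra.leftMulMatrix μ))⁰ K) =
          spanSingleton (endOrder (Algebra.leftMulMatrix μ))⁰ x * N) := by
  classical
  haveI : Nonempty ι := μ.index_nonempty
  refine (natCard_classGroup_le_natCard_quot_stratum μ μ le_rfl).trans ?_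
  rw [EndOrder.natCard_quot_fractionalIdeal_eq_sum_natCard_quot_stratum]
  refine Finset.single_le_sum (f := fun S : Subring K => Nat.card (Quot fun M N :
      {M : FractionalIdeal (endOrder (Algebra.leftMulMatrix μ))⁰ K //
        M ≠ 0 ∧ ((M / M : FractionalIdeal (endOrder (Algebra.leftMulMatrix μ))⁰ K) : Set K) = S} =>
      ∃ x : K, x ≠ 0 ∧ (M : FractionalIdeal (endOrder (Algebra.leftMulMatrix μ))⁰ K) =
        spanSingleton (endOrder (Algebra.leftMulMatrix μ))⁰ x * N)) (fun _ _ => Nat.zero_le _) ?_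
  rw [Set.Finite.mem_toFinset]
  exact ⟨le_rfl, EndOrder.moduleFinite_of_le_range (endOrder_le_range _)⟩

/-- **`#Pic(𝔯) = #ICM(𝔯)` IF AND ONLY IF `𝔯 = 𝓞_K`** («Since being invertible is a property of the ideal class we
have `Pic(R) ⊆ ICM(R)` and equality holds if and only if `R = 𝒪_K`»). [cite: Marseglia2019, §3 remark after Def. 3.5,
p. 6] [cite: Stevenhagen2008NumberRings, §5 («If `R` is Dedekind, then all fractional `R`-ideals are invertible»), p. 221] -/
theorem natCard_classGroup_eq_natCard_quot_fractionalIdeal_iff :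
    Nat.card (ClassGroup (endOrder (Algebra.leftMulMatrix μ))) =
      Nat.card (Quot fun M N : {M : FractionalIdeal (endOrder (Algebra.leftMulMatrix μ))⁰ K // M ≠ 0} =>
        ∃ x : K, x ≠ 0 ∧ (M : FractionalIdeal (endOrder (Algebra.leftMulMatrix μ))⁰ K) =
          spanSingleton (endOrder (Algebra.leftMulMatrix μ))⁰ x * N) ↔
    endOrder (Algebra.leftMulMatrix μ) = (algebraMap (𝓞 K) K).range := by
  haveI : Nonempty ι := μ.index_nonempty
  constructor
  · intro h
    by_contra hne
    have h2 := natCard_quot_stratum_add_le μ hne le_rfl (EndOrder.moduleFinite_of_le_range (endOrder_le_range _))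
      (endOrder_le_range _) (EndOrder.moduleFinite_of_le_range le_rfl)
    rw [EndOrder.natCard_quot_stratum_range_eq_classNumber, ← h] at h2
    have hP := natCard_classGroup_le_natCard_quot_stratum μ μ le_rfl
    have hK : 0 < classNumber K := by
      rw [classNumber]
      exact Fintype.card_pos
    omega
  · intro h
    haveI := (EndOrder.isDedekindDomain_iff_endOrder_eq_range (Algebra.leftMulMatrix μ)).2 h
    exact (EndOrder.natCard_quot_fractionalIdeal_eq_natCard_classGroup (ρ := Algebra.leftMulMatrix μ) (K := K)).symm

/-- **TORUS LEVEL: `#Pic(𝔯) ≤ #`(`K`-isomorphism classes of CM tori of type `(K, Φ)` with multiplication by `𝔯`),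
with equality IFF `𝔯 = 𝓞_K`** (the `Pic(𝔯)`-torsor of tori with endomorphism ring exactly `𝔯` and invertible
lattice class is all of them only for the maximal order). [cite: Shimura1998, §7.4 Prop. 17, p. 58]
[cite: Marseglia2019, §3 remark after Def. 3.5, p. 6] -/
theorem natCard_classGroup_le_natCard_quot_exists_bijective_comm_and_iff (Φ : CMType K) :
    Nat.card (ClassGroup (endOrder (Algebra.leftMulMatrix μ))) ≤
      Nat.card (Quot fun μ' μ'' : {μ' : Basis ι ℚ K //
          endOrder (Algebra.leftMulMatrix μ) ≤ endOrder (Algebra.leftMulMatrix μ')} =>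
        ∃ A : Matrix ι ι ℤ,
          Function.Bijective
              (mapMatrix (CMTorus.periodEquiv Φ (μ' : Basis ι ℚ K)) (CMTorus.periodEquiv Φ (μ'' : Basis ι ℚ K)) A) ∧
            ∀ α : K, A.map (Int.cast : ℤ → ℚ) * Algebra.leftMulMatrix (μ' : Basis ι ℚ K) α =
              Algebra.leftMulMatrix (μ'' : Basis ι ℚ K) α * A.map (Int.cast : ℤ → ℚ)) ∧
    (Nat.card (ClassGroup (endOrder (Algebra.leftMulMatrix μ))) =
      Nat.card (Quot fun μ' μ'' : {μ' : Basis ι ℚ K //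
          endOrder (Algebra.leftMulMatrix μ) ≤ endOrder (Algebra.leftMulMatrix μ')} =>
        ∃ A : Matrix ι ι ℤ,
          Function.Bijective
              (mapMatrix (CMTorus.periodEquiv Φ (μ' : Basis ι ℚ K)) (CMTorus.periodEquiv Φ (μ'' : Basis ι ℚ K)) A) ∧
            ∀ α : K, A.map (Int.cast : ℤ → ℚ) * Algebra.leftMulMatrix (μ' : Basis ι ℚ K) α =
              Algebra.leftMulMatrix (μ'' : Basis ι ℚ K) α * A.map (Int.cast : ℤ → ℚ)) ↔
      endOrder (Algebra.leftMulMatrix μ) = (algebraMap (𝓞 K) K).range) := by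
  haveI : Nonempty ι := μ.index_nonempty
  rw [natCard_quot_exists_bijective_comm_eq μ Φ]
  exact ⟨natCard_classGroup_endOrder_le_natCard_quot_fractionalIdeal μ,
    natCard_classGroup_eq_natCard_quot_fractionalIdeal_iff μ⟩

/-! ## §3 Strict monotonicity: a strictly larger order has strictly fewer classes -/

/-- **Strictly fewer classes for a strictly larger order**: if `𝔯 ⊊ S` then the classes (mod `K^×`) of lattices with
order `⊇ S` are strictly fewer than those with order `⊇ 𝔯` — the class of the lattice `⊕ ℤμⱼ` spanning `𝔯` itself
(order exactly `𝔯`) is not among the former, the order being a homothety invariant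
(`CMTorusIsomorphismClassesQuadraticOrder.endOrder_eq_of_smul_span_eq`). [cite: Marseglia2019, §3 Lemma 3.6
(«isomorphic ideals have the same multiplicator ring») and the remark after Def. 3.5, p. 6] -/
theorem natCard_quot_smul_span_eq_lt_of_lt (hlt : endOrder (Algebra.leftMulMatrix μ) < endOrder (Algebra.leftMulMatrix ν)) :
    Nat.card (Quot fun μ' μ'' : {μ' : Basis ι ℚ K //
        endOrder (Algebra.leftMulMatrix ν) ≤ endOrder (Algebra.leftMulMatrix μ')} =>
      ∃ a : K, a • Submodule.span ℤ (Set.range (μ' : Basis ι ℚ K)) = Submodule.span ℤ (Set.range (μ'' : Basis ι ℚ K))) <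
    Nat.card (Quot fun μ' μ'' : {μ' : Basis ι ℚ K //
        endOrder (Algebra.leftMulMatrix μ) ≤ endOrder (Algebra.leftMulMatrix μ')} =>
      ∃ a : K, a • Submodule.span ℤ (Set.range (μ' : Basis ι ℚ K)) = Submodule.span ℤ (Set.range (μ'' : Basis ι ℚ K))) := by
  haveI : Nonempty ι := μ.index_nonempty
  haveI := EndOrder.finite_quot_fractionalIdeal (ρ := Algebra.leftMulMatrix μ) (K := K)
  haveI : Finite (Quot fun μ' μ'' : {μ' : Basis ι ℚ K //
        endOrder (Algebra.leftMulMatrix μ) ≤ endOrder (Algebra.leftMulMatrix μ')} =>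
      ∃ a : K, a • Submodule.span ℤ (Set.range (μ' : Basis ι ℚ K)) = Submodule.span ℤ (Set.range (μ'' : Basis ι ℚ K))) :=
    Finite.of_equiv _ (nonempty_quot_smul_span_eq_equiv_quot_fractionalIdeal μ).some.symm
  set r : {μ' : Basis ι ℚ K // endOrder (Algebra.leftMulMatrix μ) ≤ endOrder (Algebra.leftMulMatrix μ')} →
      {μ' : Basis ι ℚ K // endOrder (Algebra.leftMulMatrix μ) ≤ endOrder (Algebra.leftMulMatrix μ')} → Prop :=
    fun μ' μ'' => ∃ a : K, a • Submodule.span ℤ (Set.range (μ' : Basis ι ℚ K)) =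
      Submodule.span ℤ (Set.range (μ'' : Basis ι ℚ K)) with hr
  have hequiv : Equivalence r :=
    equivalence_exists_smul_span_eq fun μ' : Basis ι ℚ K => endOrder (Algebra.leftMulMatrix μ) ≤ endOrder (Algebra.leftMulMatrix μ')
  let g : {μ' : Basis ι ℚ K // endOrder (Algebra.leftMulMatrix ν) ≤ endOrder (Algebra.leftMulMatrix μ')} →
      {μ' : Basis ι ℚ K // endOrder (Algebra.leftMulMatrix μ) ≤ endOrder (Algebra.leftMulMatrix μ')} :=
    fun b => ⟨(b : Basis ι ℚ K), hlt.le.trans b.2⟩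
  let G : (Quot fun μ' μ'' : {μ' : Basis ι ℚ K //
        endOrder (Algebra.leftMulMatrix ν) ≤ endOrder (Algebra.leftMulMatrix μ')} =>
      ∃ a : K, a • Submodule.span ℤ (Set.range (μ' : Basis ι ℚ K)) = Submodule.span ℤ (Set.range (μ'' : Basis ι ℚ K))) →
      Quot r := Quot.lift (fun b => Quot.mk r (g b)) fun b b' h => Quot.sound h
  have hinj : Function.Injective G := fun q₁ q₂ h => by
    induction q₁ using Quot.ind with
    | mk b =>
      induction q₂ using Quot.ind with
      | mk b' =>
        have h' : Quot.mk r (g b) = Quot.mk r (g b') := h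
        obtain ⟨a, ha⟩ := (hequiv.eqvGen_iff).1 (Quot.eqvGen_exact h')
        exact Quot.sound ⟨a, ha⟩
  -- the class of `𝔯` itself is not hit
  have hnot : ¬ Function.Surjective G := by
    intro hsurj
    obtain ⟨q, hq⟩ := hsurj (Quot.mk r ⟨μ, le_rfl⟩)
    induction q using Quot.ind with
    | mk b =>
      have h' : Quot.mk r (g b) = Quot.mk r ⟨μ, le_rfl⟩ := hq
      obtain ⟨a, ha⟩ := (hequiv.eqvGen_iff).1 (Quot.eqvGen_exact h')
      have hend := endOrder_eq_of_smul_span_eq (b : Basis ι ℚ K) μ ha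
      exact lt_irrefl _ (hlt.trans_le (b.2.trans hend.le))
  by_contra hge
  exact hnot (hinj.bijective_of_nat_card_le (not_lt.1 hge)).2

/-- **TORUS LEVEL, strict: if `𝔯 ⊊ S`, the CM tori of type `(K, Φ)` with `ι(S) ⊆ End` fall into STRICTLY FEWER
`K`-isomorphism classes than those with `ι(𝔯) ⊆ End`** (the torus `ℂ^Φ/D(𝔯)` has endomorphism order exactly `𝔯`).
[cite: Shimura1998, §7.4 (the order `ι⁻¹[End(A) ∩ ι(F)]` of `(A, ι)`), pp. 57–58] [cite: Marseglia2019, §3 Lemma 3.6, p. 6] -/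
theorem natCard_quot_exists_bijective_comm_lt_of_lt (Φ : CMType K)
    (hlt : endOrder (Algebra.leftMulMatrix μ) < endOrder (Algebra.leftMulMatrix ν)) :
    Nat.card (Quot fun μ' μ'' : {μ' : Basis ι ℚ K //
        endOrder (Algebra.leftMulMatrix ν) ≤ endOrder (Algebra.leftMulMatrix μ')} =>
      ∃ A : Matrix ι ι ℤ,
        Function.Bijective
            (mapMatrix (CMTorus.periodEquiv Φ (μ' : Basis ι ℚ K)) (CMTorus.periodEquiv Φ (μ'' : Basis ι ℚ K)) A) ∧
          ∀ α : K, A.map (Int.cast : ℤ → ℚ) * Algebra.leftMulMatrix (μ' : Basis ι ℚ K) α =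
            Algebra.leftMulMatrix (μ'' : Basis ι ℚ K) α * A.map (Int.cast : ℤ → ℚ)) <
    Nat.card (Quot fun μ' μ'' : {μ' : Basis ι ℚ K //
        endOrder (Algebra.leftMulMatrix μ) ≤ endOrder (Algebra.leftMulMatrix μ')} =>
      ∃ A : Matrix ι ι ℤ,
        Function.Bijective
            (mapMatrix (CMTorus.periodEquiv Φ (μ' : Basis ι ℚ K)) (CMTorus.periodEquiv Φ (μ'' : Basis ι ℚ K)) A) ∧
          ∀ α : K, A.map (Int.cast : ℤ → ℚ) * Algebra.leftMulMatrix (μ' : Basis ι ℚ K) α =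
            Algebra.leftMulMatrix (μ'' : Basis ι ℚ K) α * A.map (Int.cast : ℤ → ℚ)) := by
  convert natCard_quot_smul_span_eq_lt_of_lt μ ν hlt using 1
  · exact Nat.card_congr (Quot.congrRight fun b b' =>
      exists_bijective_comm_iff_exists_smul_span_eq Φ (b : Basis ι ℚ K) (b' : Basis ι ℚ K))
  · exact Nat.card_congr (Quot.congrRight fun b b' =>
      exists_bijective_comm_iff_exists_smul_span_eq Φ (b : Basis ι ℚ K) (b' : Basis ι ℚ K))

/-- **`#ICM(S) < #ICM(𝔯)` for orders `𝔯 ⊊ S`.** [cite: Marseglia2019, §3 Lemma 3.6 and the remark after Def. 3.5, p. 6] -/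
theorem natCard_quot_fractionalIdeal_lt_of_lt [IsFractionRing (endOrder (Algebra.leftMulMatrix ν)) K]
    (hlt : endOrder (Algebra.leftMulMatrix μ) < endOrder (Algebra.leftMulMatrix ν)) :
    Nat.card (Quot fun M N : {M : FractionalIdeal (endOrder (Algebra.leftMulMatrix ν))⁰ K // M ≠ 0} =>
      ∃ x : K, x ≠ 0 ∧ (M : FractionalIdeal (endOrder (Algebra.leftMulMatrix ν))⁰ K) =
        spanSingleton (endOrder (Algebra.leftMulMatrix ν))⁰ x * N) <
    Nat.card (Quot fun M N : {M : FractionalIdeal (endOrder (Algebra.leftMulMatrix μ))⁰ K // M ≠ 0} =>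
      ∃ x : K, x ≠ 0 ∧ (M : FractionalIdeal (endOrder (Algebra.leftMulMatrix μ))⁰ K) =
        spanSingleton (endOrder (Algebra.leftMulMatrix μ))⁰ x * N) := by
  rw [← natCard_quot_smul_span_eq_eq ν, ← natCard_quot_smul_span_eq_eq μ]
  exact natCard_quot_smul_span_eq_lt_of_lt μ ν hlt

end Monotone

end CMTypeLattice

end Literature.NumberTheory.ComplexMultiplication
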